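import Summits.ResolutionOfSingularities.ResolutionOfSingularities.Theorems.LossTaylor
import HarnessLib

/-!
# LossEntryPolygon — the loss→entry law at the polygon level: after the two shears of a (b)-loss move and the cleaning,
the lexicographic minimum `(ε, ŷ)` of the ENTRY points `(N/D, a/D)` satisfies `ε ≤ α + β − 1` (E2) and `ŷ ≤ 1 − α + ε` (E3′),
hence `ŷ ≤ β` (E3) and `ε + ŷ − 1 < β` whenever `ε < 1`

decomp-res-lens-3, gen 28 (NODE-g28 §6.8 F21/R2 and §6.10; sequel of `Theorems.LossTaylor`).  TOOLS at 0: walk-free algebra over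
`polyPts` / `vertexOf` of `Theorems.LossPolygon*` and the shear calculus of `Theorems.LossShear` / `Theorems.LossTaylor`.
The walk-level law `lawLossEntry` (LossDescent) follows from these by the transport identities FACT 0 (`α_u = ε`, `β_u = ε + ŷ − 1`
for the run state after the untranslated repeat), the axis law (A) (`ε ≤ 1 − (d+1)/s`) and the `q`-th-power bound (B) (discharging
the survival hypothesis `hsurv`) — the successor generation's plumbing.  Desk evidence: E2/E3/E3′ exact in 11 823 legal loss samples
(HOME/decomp-res-lens-3/g28/f14/RESULTS.md).

* §6 `entryPt`, `entryPts` — the entry point `(N/D, a/D) = ((deg E − o)/(s − E l), E i/(s − E l))` and the entry point set.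
* §7 `alphaOf_entryPts_le` — E2: the vertex monomial of `F` survives both shears and the cleaning, so `ε ≤ α + β − 1`.
* §8 `betaOf_entryPts_le` — E3′: `ŷ ≤ 1 − α + ε` (the line of the minimum carries, by `exists_coeff_two_shears_ne_zero_le`, a surviving
  monomial with `i`-exponent `≤ B − k`, and the source bound `cast_sub_wall_le` gives `B − k ≤ (1 − α) D_P + N_P`);
  `betaOf_entryPts_le_betaOf` — E3: `ŷ ≤ β`; `entry_lt_betaOf` — the law `ε + ŷ − 1 < β` under `ε < 1`.
-/

open MvPolynomial Finset
open Literature.AlgebraicGeometry.Resolution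
open Literature.AlgebraicGeometry.Resolution.Hauser2010
open Literature.AlgebraicGeometry.Resolution.PointBlowup
open Summit.ResolutionOfSingularities.ResolutionOfSingularities.Theorems.LossExitCone

namespace Summit.ResolutionOfSingularities.ResolutionOfSingularities.Theorems.LossPolygon

variable {K : Type} [Field K]

/-! ## §6 The virtual ENTRY point set `(N/D, a/D)` of the equation after the two shears of a loss move -/

section Entry

variable {i j l : Fin 3}

/-- The virtual entry point of an exponent `E` for the frame `(j, i ; l)`, shade `s`, old order `o`:
`(N/D, a/D) = ((deg E − o)/(s − E l), E i/(s − E l))`.  By NODE-g28 §6.8 FACT 0 the polygon of the first run state after a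
(b)-loss + repeat is the image of these points under `(x, y) ↦ (x, x + y − 1)`, so its vertex is read off the lexicographic
minimum of the entry points. [new object] -/
noncomputable def entryPt (s o : ℕ) (i l : Fin 3) (E : Fin 3 →₀ ℕ) : ℚ × ℚ :=
  (((((E.degree : ℕ) : ℚ)) - o) / (((s : ℕ) : ℚ) - E l), ((E i : ℕ) : ℚ) / (((s : ℕ) : ℚ) - E l))

/-- The entry point set of `G`: entry points of the monomials below the ceiling `E l < s`. [new object] -/
noncomputable def entryPts (s o : ℕ) (i l : Fin 3) (G : MvPolynomial (Fin 3) K) : Finset (ℚ × ℚ) :=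
  (G.support.filter fun E => E l < s).image (entryPt s o i l)

/-- `entryPt_mem_entryPts`: membership rule. [new; elementary] -/
theorem entryPt_mem_entryPts (s o : ℕ) (i l : Fin 3) (G : MvPolynomial (Fin 3) K) {E : Fin 3 →₀ ℕ} (hE : E ∈ G.support)
    (hEl : E l < s) : entryPt s o i l E ∈ entryPts s o i l G :=
  Finset.mem_image.mpr ⟨E, Finset.mem_filter.mpr ⟨hE, hEl⟩, rfl⟩

/-- `fst_entryPt`: the abscissa depends only on the degree and the `l`-exponent. [new; elementary] -/
theorem fst_entryPt (s o : ℕ) (i l : Fin 3) (E : Fin 3 →₀ ℕ) :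
    (entryPt s o i l E).1 = ((((E.degree : ℕ) : ℚ)) - o) / (((s : ℕ) : ℚ) - E l) := rfl

/-- `snd_entryPt`: the ordinate. [new; elementary] -/
theorem snd_entryPt (s o : ℕ) (i l : Fin 3) (E : Fin 3 →₀ ℕ) :
    (entryPt s o i l E).2 = ((E i : ℕ) : ℚ) / (((s : ℕ) : ℚ) - E l) := rfl

/-! ## §7 E2: the vertex monomial survives both shears and the cleaning, so `ε ≤ α + β − 1` -/

/-- **E2 (PROVED): `ε ≤ α + β − 1`.**  In the frame `(j, i ; l)` (`r l = 0`, walls divide, `F` clean, `α < 1`) the vertex monomial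
of `F` keeps its coefficient under `σ_{l,j,g}` (V-lemma core `alphaOf_lt_fst_resPoint_shearExp`) and under `σ_{i,j,φ}` (a source would
lie at abscissa `< α`), is not a `q`-th power, and its entry point has abscissa `(deg − o)/(s − c) = α + β − 1`.
[NODE-g28 §6.8 R2/E2; CJS2020 Lemma 13.3 geometry; for the walk: new] -/
theorem alphaOf_entryPts_le (hij : i ≠ j) (hil : i ≠ l) (hjl : j ≠ l) {q s : ℕ} {r : Fin 3 →₀ ℕ} (hrl : r l = 0) (φ g : K)
    {F : MvPolynomial (Fin 3) K} (hclean : ∀ D ∈ F.support, ¬ IsPthPowerExponent q D)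
    (hwall : ∀ D ∈ F.support, r ≤ D) (hne : (polyPts s r j i l F).Nonempty) (hα : alphaOf (polyPts s r j i l F) < 1) :
    alphaOf (entryPts s (r i + r j + s) i l (deletePthPowers q (shear i j φ (shear l j g F)))) ≤
      alphaOf (polyPts s r j i l F) + betaOf (polyPts s r j i l F) - 1 := by
  classical
  set Pt := polyPts s r j i l F with hPt
  obtain ⟨Dv, hDv, hDve⟩ := Finset.mem_image.mp (vertexOf_mem hne)
  obtain ⟨hDvF, hDvc⟩ := Finset.mem_filter.mp hDv
  rw [hrl, add_zero] at hDvc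
  have hraj : ∀ D ∈ F.support, r j ≤ D j := fun D hD => Finsupp.le_def.mp (hwall D hD) j
  -- (1) the free-letter shear keeps the coefficient of `Dv`
  have h1 : coeff Dv (shear l j g F) = coeff Dv F := by
    refine coeff_shear_eq_coeff hij.symm hjl hil g F fun D hD n hn1 hnD heq => ?_
    have hEc : D l - n < s := by
      have := congrArg (fun E => E l) heq
      simp only [shearExp_apply_thd hjl hil] at this
      omega
    have hlt := alphaOf_lt_fst_resPoint_shearExp hij.symm hjl hil hrl hα hD (hraj D hD) hn1 hnD hEc
    rw [heq, hDve] at hlt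
    exact lt_irrefl _ hlt
  -- (2) the run-wall shear keeps it too: a source would have abscissa `< α = α(σ_{l,j,g} F)`
  have hvH : vertexOf (polyPts s r j i l (shear l j g F)) = vertexOf Pt :=
    vertexOf_polyPts_shear hij.symm hjl hil hrl g hraj hne hα
  have h2 : coeff Dv (shear i j φ (shear l j g F)) = coeff Dv (shear l j g F) := by
    refine coeff_shear_eq_coeff hjl hij.symm hil.symm φ (shear l j g F) fun D hD n hn1 hnD heq => ?_
    have hj' : D j + n = Dv j := by
      have := congrArg (fun E => E j) heq; simpa [shearExp_apply_fst hjl hij.symm] using this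
    have hl' : D l = Dv l := by
      have := congrArg (fun E => E l) heq; simpa [shearExp_apply_snd hjl hil.symm] using this
    have hmem : resPoint s r j i l D ∈ polyPts s r j i l (shear l j g F) :=
      resPoint_mem_polyPts s r j i l _ hD (by rw [hrl, hl']; omega)
    have hle := alphaOf_le_fst hmem
    have hαH : alphaOf (polyPts s r j i l (shear l j g F)) = alphaOf Pt := congrArg Prod.fst hvH
    have hαv : alphaOf Pt = (resPoint s r j i l Dv).1 := by rw [hDve]; rfl
    rw [hαH, hαv] at hle
    simp only [resPoint, hrl, Nat.cast_zero, add_zero, hl'] at hle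
    have hpos : (0 : ℚ) < ((s : ℕ) : ℚ) - Dv l := by
      have : ((Dv l : ℕ) : ℚ) < s := by exact_mod_cast hDvc
      linarith
    have hj'' : ((D j : ℕ) : ℚ) + n = Dv j := by exact_mod_cast hj'
    have hn1' : (1 : ℚ) ≤ n := by exact_mod_cast hn1
    -- `hle : (Dv j - r j)/(s - Dv l) ≤ (D j - r j)/(s - Dv l)` contradicts `D j = Dv j - n < Dv j`
    rw [div_le_div_iff_of_pos_right hpos] at hle
    linarith
  -- (3) hence `Dv` is a monomial of the cleaned sheared equation
  have h3 : Dv ∈ (deletePthPowers q (shear i j φ (shear l j g F))).support := by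
    rw [mem_support_iff, coeff_deletePthPowers, if_neg (hclean Dv hDvF), h2, h1]
    exact mem_support_iff.mp hDvF
  -- (4) its entry abscissa is `α + β − 1`
  have hle := alphaOf_le_fst (entryPt_mem_entryPts s (r i + r j + s) i l _ h3 hDvc)
  refine hle.trans (le_of_eq ?_)
  have hv1 : alphaOf Pt = (resPoint s r j i l Dv).1 := by rw [hDve]; rfl
  have hv2 : betaOf Pt = (resPoint s r j i l Dv).2 := by rw [hDve]; rfl
  rw [fst_entryPt, hv1, hv2]
  simp only [resPoint, hrl, Nat.cast_zero, add_zero, degree_fin3 hij hil hjl Dv]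
  have hpos : (0 : ℚ) < ((s : ℕ) : ℚ) - Dv l := by
    have : ((Dv l : ℕ) : ℚ) < s := by exact_mod_cast hDvc
    linarith
  push_cast
  field_simp
  ring

/-! ## §8 E3′: the entry ordinate is at most `1 − α + ε` -/

/-- **E3′ (PROVED): `ŷ ≤ 1 − α + ε`.**  Let `P = (ε, ŷ)` be the lexicographic minimum of the entry points of
`G = clean(σ_{i,j,φ} σ_{l,j,g} F)` (`φ ≠ 0`, walls divide, `α ≤ 1`), and assume every monomial of the uncleaned `σF` below the
ceiling with entry abscissa `ε` survives the cleaning (on a deep tail: `q`-th powers have abscissa `≥ (s−d)/s > ε`, NODE-g28 §6.8 (A),(B)).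
Then the line of `P` carries, by §5, a monomial with `i`-exponent `a ≤ B − k`, which survives and lies at abscissa `ε`, so
`a_P ≤ a`; and the source bound §4 gives `B − k ≤ (1 − α)(s − c_P) + N_P`. [NODE-g28 §6.8 F21; for the walk: new] -/
theorem betaOf_entryPts_le (hij : i ≠ j) (hil : i ≠ l) (hjl : j ≠ l) {q s : ℕ} {r : Fin 3 →₀ ℕ} (hrl : r l = 0) {φ : K}
    (hφ : φ ≠ 0) (g : K) {F : MvPolynomial (Fin 3) K} (hwall : ∀ D ∈ F.support, r ≤ D)
    (hα1 : alphaOf (polyPts s r j i l F) ≤ 1)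
    (hsurv : ∀ E ∈ (shear i j φ (shear l j g F)).support, E l < s →
      (entryPt s (r i + r j + s) i l E).1 =
        alphaOf (entryPts s (r i + r j + s) i l (deletePthPowers q (shear i j φ (shear l j g F)))) →
      ¬ IsPthPowerExponent q E)
    (hne : (entryPts s (r i + r j + s) i l (deletePthPowers q (shear i j φ (shear l j g F)))).Nonempty) :
    betaOf (entryPts s (r i + r j + s) i l (deletePthPowers q (shear i j φ (shear l j g F)))) ≤
      1 - alphaOf (polyPts s r j i l F) +
        alphaOf (entryPts s (r i + r j + s) i l (deletePthPowers q (shear i j φ (shear l j g F)))) := by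
  classical
  set σF := shear i j φ (shear l j g F) with hσF
  set G := deletePthPowers q σF with hG
  set o := r i + r j + s with ho
  set EP := entryPts s o i l G with hEP
  set α := alphaOf (polyPts s r j i l F) with hαdef
  obtain ⟨E, hEmem, hEe⟩ := Finset.mem_image.mp (vertexOf_mem hne)
  obtain ⟨hEG, hEl⟩ := Finset.mem_filter.mp hEmem
  have hEσ : E ∈ σF.support := by
    have h := hEG; rw [hG, support_deletePthPowers'] at h; exact (Finset.mem_filter.mp h).1
  -- the line of `E`
  set S := E i + E j with hS
  set c := E l with hc
  have hline : lineExp i j l S c (E i) = E := (lineExp_eq_iff hij hil hjl S c (E i) E).mpr ⟨rfl, by omega, rfl⟩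
  have h0 : coeff (lineExp i j l S c (E i)) σF ≠ 0 := by rw [hline]; exact mem_support_iff.mp hEσ
  -- the sources of the line and the bound `B`
  set Src := F.support.filter fun D => D.degree = S + c ∧ c ≤ D l with hSrc
  set B := Src.sup fun D => D i with hB
  have hBle : ∀ D ∈ F.support, D.degree = S + c → c ≤ D l → D i ≤ B := fun D hD h1 h2 =>
    Finset.le_sup (f := fun D => D i) (Finset.mem_filter.mpr ⟨hD, h1, h2⟩)
  obtain ⟨a, hak, haS, ha⟩ := exists_coeff_two_shears_ne_zero_le hij hil hjl hφ g S c (r i) B F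
    (fun D hD => Finsupp.le_def.mp (hwall D hD) i) hBle (by omega) h0
  -- `Src` is inhabited (the line of `σ_{l,j,g} F` is), so `B = D⋆ i` for a source `D⋆`
  have hSrcne : Src.Nonempty := by
    obtain ⟨a', ha', hne'⟩ := exists_coeff_lineExp_ne_zero_of_shear hij hil hjl φ S c (shear l j g F) (by omega) h0
    obtain ⟨D₀, hD₀, -, hD₀l, hD₀d⟩ := exists_source_of_coeff_lineExp_shear_free hij hil hjl g S c F ha' hne'
    exact ⟨D₀, Finset.mem_filter.mpr ⟨hD₀, hD₀d, hD₀l⟩⟩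
  obtain ⟨Dst, hDst, hDstB⟩ := Finset.exists_mem_eq_sup Src hSrcne fun D => D i
  obtain ⟨hDstF, hDstd, hDstc⟩ := Finset.mem_filter.mp hDst
  -- the monomial found by §5 survives and lies on the abscissa of `P`
  set Ea := lineExp i j l S c a with hEa
  have hEaσ : Ea ∈ σF.support := mem_support_iff.mpr ha
  have hEal : Ea l = c := lineExp_apply_thd hil hjl S c a
  have hEai : Ea i = a := lineExp_apply_fst hij hil S c a
  have hEadeg : Ea.degree = S + c := by
    rw [degree_fin3 hij hil hjl Ea, hEai, lineExp_apply_snd hij hjl S c a, hEal]; omega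
  have hEdeg : E.degree = S + c := by rw [degree_fin3 hij hil hjl E]
  have hfst : (entryPt s o i l Ea).1 = (entryPt s o i l E).1 := by
    rw [fst_entryPt, fst_entryPt, hEadeg, hEdeg, hEal]
  have hPfst : (entryPt s o i l E).1 = alphaOf EP := by rw [hEe]; rfl
  have hEaG : Ea ∈ G.support := by
    rw [hG, support_deletePthPowers']
    exact Finset.mem_filter.mpr ⟨hEaσ, hsurv Ea hEaσ (by rw [hEal]; exact hEl) (hfst.trans hPfst)⟩
  have hmemEa : entryPt s o i l Ea ∈ EP := entryPt_mem_entryPts s o i l G hEaG (by rw [hEal]; exact hEl)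
  have hlex := vertexOf_le hmemEa
  have hPdef : vertexOf EP = entryPt s o i l E := hEe.symm
  rw [toLex_le_toLex_iff, hPdef] at hlex
  have hP2 : (entryPt s o i l E).2 ≤ (entryPt s o i l Ea).2 := by
    rcases hlex with h | ⟨-, h⟩
    · rw [hfst] at h; exact absurd h (lt_irrefl _)
    · exact h
  -- arithmetic: `a ≤ B − k ≤ (1 − α)(s − c) + (S + c − o)`
  have hpos : (0 : ℚ) < ((s : ℕ) : ℚ) - c := by
    have : ((c : ℕ) : ℚ) < s := by exact_mod_cast hEl
    linarith
  have hα0 : (0 : ℚ) ≤ 1 - α := by linarith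
  have hkey : ((a : ℕ) : ℚ) ≤ (1 - α) * (((s : ℕ) : ℚ) - c) + ((((S + c : ℕ) : ℚ)) - o) := by
    have hak' : ((a : ℕ) : ℚ) + r i ≤ Dst i := by rw [← hDstB]; exact_mod_cast hak
    by_cases hDl : Dst l < s
    · have hD := cast_sub_wall_le hij hil hjl s r hrl F hDstF hDl
      rw [hDstd] at hD
      have hcl : ((c : ℕ) : ℚ) ≤ Dst l := by exact_mod_cast hDstc
      have hmono : (1 - α) * (((s : ℕ) : ℚ) - Dst l) ≤ (1 - α) * (((s : ℕ) : ℚ) - c) :=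
        mul_le_mul_of_nonneg_left (by linarith) hα0
      have ho' : ((o : ℕ) : ℚ) = r i + r j + s := by rw [ho]; push_cast; ring
      rw [ho']; push_cast at hD ⊢; linarith
    · have hD := add_wall_le_degree hij hil hjl s r (D := Dst) (Finsupp.le_def.mp (hwall Dst hDstF) j) (not_lt.mp hDl)
      rw [hDstd] at hD
      have hD' : ((Dst i : ℕ) : ℚ) + r j + s ≤ ((S + c : ℕ) : ℚ) := by exact_mod_cast hD
      have hnn : (0 : ℚ) ≤ (1 - α) * (((s : ℕ) : ℚ) - c) := mul_nonneg hα0 hpos.le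
      have ho' : ((o : ℕ) : ℚ) = r i + r j + s := by rw [ho]; push_cast; ring
      rw [ho']; linarith
  -- conclude
  have hβ : betaOf EP = (entryPt s o i l E).2 := by rw [hEe]; rfl
  rw [hβ]
  refine hP2.trans ?_
  rw [snd_entryPt, hEai, hEal, ← hPfst, fst_entryPt, hEdeg]
  rw [div_le_iff₀ hpos, add_mul, div_mul_cancel₀ _ hpos.ne']
  linarith

/-- **E3 (PROVED, corollary of E2 and E3′): the entry ordinate is at most `β`.** [NODE-g28 §6.8 R2/E3 (exact in 11 823 desk rows); new] -/
theorem betaOf_entryPts_le_betaOf (hij : i ≠ j) (hil : i ≠ l) (hjl : j ≠ l) {q s : ℕ} {r : Fin 3 →₀ ℕ} (hrl : r l = 0)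
    {φ : K} (hφ : φ ≠ 0) (g : K) {F : MvPolynomial (Fin 3) K} (hclean : ∀ D ∈ F.support, ¬ IsPthPowerExponent q D)
    (hwall : ∀ D ∈ F.support, r ≤ D) (hneF : (polyPts s r j i l F).Nonempty) (hα : alphaOf (polyPts s r j i l F) < 1)
    (hsurv : ∀ E ∈ (shear i j φ (shear l j g F)).support, E l < s →
      (entryPt s (r i + r j + s) i l E).1 =
        alphaOf (entryPts s (r i + r j + s) i l (deletePthPowers q (shear i j φ (shear l j g F)))) →
      ¬ IsPthPowerExponent q E)
    (hne : (entryPts s (r i + r j + s) i l (deletePthPowers q (shear i j φ (shear l j g F)))).Nonempty) :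
    betaOf (entryPts s (r i + r j + s) i l (deletePthPowers q (shear i j φ (shear l j g F)))) ≤
      betaOf (polyPts s r j i l F) := by
  have h1 := betaOf_entryPts_le hij hil hjl hrl hφ g hwall hα.le hsurv hne (q := q)
  have h2 := alphaOf_entryPts_le hij hil hjl hrl φ g hclean hwall hneF hα (q := q)
  linarith

/-- **THE ENTRY LAW AT THE POLYGON LEVEL (PROVED): `ε + ŷ − 1 < β` when `ε < 1`.**  With FACT 0 (`β_u = ε + ŷ − 1`, `α_u = ε`)
this is `β_u < β_t` for a (b)-loss followed by its untranslated repeat. [NODE-g28 §6.8 F21; new] -/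
theorem entry_lt_betaOf (hij : i ≠ j) (hil : i ≠ l) (hjl : j ≠ l) {q s : ℕ} {r : Fin 3 →₀ ℕ} (hrl : r l = 0)
    {φ : K} (hφ : φ ≠ 0) (g : K) {F : MvPolynomial (Fin 3) K} (hclean : ∀ D ∈ F.support, ¬ IsPthPowerExponent q D)
    (hwall : ∀ D ∈ F.support, r ≤ D) (hneF : (polyPts s r j i l F).Nonempty) (hα : alphaOf (polyPts s r j i l F) < 1)
    (hsurv : ∀ E ∈ (shear i j φ (shear l j g F)).support, E l < s →
      (entryPt s (r i + r j + s) i l E).1 =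
        alphaOf (entryPts s (r i + r j + s) i l (deletePthPowers q (shear i j φ (shear l j g F)))) →
      ¬ IsPthPowerExponent q E)
    (hne : (entryPts s (r i + r j + s) i l (deletePthPowers q (shear i j φ (shear l j g F)))).Nonempty)
    (hε : alphaOf (entryPts s (r i + r j + s) i l (deletePthPowers q (shear i j φ (shear l j g F)))) < 1) :
    alphaOf (entryPts s (r i + r j + s) i l (deletePthPowers q (shear i j φ (shear l j g F)))) +
        betaOf (entryPts s (r i + r j + s) i l (deletePthPowers q (shear i j φ (shear l j g F)))) - 1 <
      betaOf (polyPts s r j i l F) := by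
  have h := betaOf_entryPts_le_betaOf hij hil hjl hrl hφ g hclean hwall hneF hα hsurv hne (q := q)
  linarith

end Entry

end Summit.ResolutionOfSingularities.ResolutionOfSingularities.Theorems.LossPolygon
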